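import Mathlib
import Literature.Computability.Complexity.CNF
import Literature.Computability.Complexity.PNPWave0

/-!
# Route OverlapGapAlgebra, crux `SolvableImpliesStableSection` (stmt-PneNP-2463), line `Sketch`:
# calibration — the UNSATISFIABLE regime: no solver succeeds at density `α ≥ 2^k`

First-moment bound for random `k`-SAT in the with-replacement literal model of the route
(`Φ : Fin m → Fin k → Fin n × Bool`, literal `(v, b)` true under `σ` iff `σ v = b`): a fixed assignment
`σ` satisfies a uniformly random clause with probability exactly `1 - 2^{-k}` (`ur_card_satClauses`), so
`#{Φ satisfiable} ≤ 2^n (1 - 2^{-k})^m · #instances` (`ur_sat_fraction_le`), which at `m = ⌊α n⌋₊`,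
`α ≥ 2^k`, is `≤ e·(2/e)^n → 0`. Consequently NO map `f` whatsoever (efficient or not) outputs satisfying
assignments with non-vanishing probability there (`ur_no_solver`), i.e. the hypothesis of
`SolvableImpliesStableSection` fails and the crux holds vacuously at every `(k ≥ 1, α ≥ 2^k)`
(`solvableImpliesStableSection_of_density_ge`, stated for the crux's exact hypothesis shape).
Together with the constant-section calibration (`ν > 2^{-k}`) this brackets the contentful regime of
the crux: `α < 2^k` and `ν ≤ 2^{-k}`.
-/

set_option linter.dupNamespace false -- `Summit.PneNP.PneNP.…`: summit = sub-problem (D-0017)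

namespace Summit.PneNP.PneNP.Cruxes.SolvableImpliesStableSection.Sketch

open Finset
open scoped Classical

/-- Literals false under `σ`: `#{ℓ : Fin n × Bool | σ ℓ.1 ≠ ℓ.2} = n`. -/
theorem ur_card_falseLits (n : ℕ) (σ : Fin n → Bool) :
    ((univ : Finset (Fin n × Bool)).filter fun ℓ => σ ℓ.1 ≠ ℓ.2).card = n := by
  have h : ((univ : Finset (Fin n × Bool)).filter fun ℓ => σ ℓ.1 ≠ ℓ.2)
      = (univ : Finset (Fin n)).image fun v => (v, !σ v) := by
    ext ⟨v, b⟩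
    simp only [mem_filter, mem_univ, true_and, mem_image, Prod.mk.injEq]
    constructor
    · intro hb
      refine ⟨v, rfl, ?_⟩
      cases hσ : σ v <;> cases b <;> simp_all
    · rintro ⟨w, rfl, hw⟩
      rw [← hw]
      cases σ w <;> simp
  rw [h, Finset.card_image_of_injective _ (fun v w hvw => (Prod.mk.injEq _ _ _ _ ▸ hvw).1),
    Finset.card_univ, Fintype.card_fin]

/-- Clauses violated by `σ` (all `k` literals false): exactly `n^k` of the `(2n)^k` clauses. -/
theorem ur_card_unsatClauses (n k : ℕ) (σ : Fin n → Bool) :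
    ((univ : Finset (Fin k → Fin n × Bool)).filter fun cl => ∀ j, σ (cl j).1 ≠ (cl j).2).card
      = n ^ k := by
  have h : ((univ : Finset (Fin k → Fin n × Bool)).filter fun cl => ∀ j, σ (cl j).1 ≠ (cl j).2)
      = Fintype.piFinset fun _ : Fin k => (univ : Finset (Fin n × Bool)).filter fun ℓ => σ ℓ.1 ≠ ℓ.2 := by
    ext cl
    simp [Fintype.mem_piFinset]
  rw [h, Fintype.card_piFinset_const, ur_card_falseLits]

/-- Clauses satisfied by `σ`: `(2n)^k - n^k`. -/
theorem ur_card_satClauses (n k : ℕ) (σ : Fin n → Bool) :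
    ((univ : Finset (Fin k → Fin n × Bool)).filter fun cl => ∃ j, σ (cl j).1 = (cl j).2).card
      = (2 * n) ^ k - n ^ k := by
  have hsplit := Finset.card_filter_add_card_filter_not
    (s := (univ : Finset (Fin k → Fin n × Bool))) (fun cl => ∃ j, σ (cl j).1 = (cl j).2)
  have hneg : ((univ : Finset (Fin k → Fin n × Bool)).filter fun cl => ¬ ∃ j, σ (cl j).1 = (cl j).2)
      = (univ.filter fun cl => ∀ j, σ (cl j).1 ≠ (cl j).2) := by
    congr 1; ext cl; simp
  rw [hneg, ur_card_unsatClauses, Finset.card_univ, Fintype.card_fun, Fintype.card_prod,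
    Fintype.card_fin, Fintype.card_fin, Fintype.card_bool] at hsplit
  rw [show 2 * n = n * 2 by ring]
  omega

/-- Instances satisfied by a FIXED `σ`: `((2n)^k - n^k)^m`. -/
theorem ur_card_satBy (n k m : ℕ) (σ : Fin n → Bool) :
    ((univ : Finset (Fin m → Fin k → Fin n × Bool)).filter fun Φ =>
        ∀ i, ∃ j, σ (Φ i j).1 = (Φ i j).2).card = ((2 * n) ^ k - n ^ k) ^ m := by
  have h : ((univ : Finset (Fin m → Fin k → Fin n × Bool)).filter fun Φ =>
        ∀ i, ∃ j, σ (Φ i j).1 = (Φ i j).2)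
      = Fintype.piFinset fun _ : Fin m =>
          (univ : Finset (Fin k → Fin n × Bool)).filter fun cl => ∃ j, σ (cl j).1 = (cl j).2 := by
    ext Φ
    simp [Fintype.mem_piFinset]
  rw [h, Fintype.card_piFinset_const, ur_card_satClauses]

/-- **First moment.** `#{Φ satisfiable} ≤ 2^n · ((2n)^k - n^k)^m`. -/
theorem ur_card_sat_le (n k m : ℕ) :
    ((univ : Finset (Fin m → Fin k → Fin n × Bool)).filter fun Φ =>
        ∃ σ : Fin n → Bool, ∀ i, ∃ j, σ (Φ i j).1 = (Φ i j).2).card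
      ≤ 2 ^ n * ((2 * n) ^ k - n ^ k) ^ m := by
  have hsub : ((univ : Finset (Fin m → Fin k → Fin n × Bool)).filter fun Φ =>
        ∃ σ : Fin n → Bool, ∀ i, ∃ j, σ (Φ i j).1 = (Φ i j).2)
      ⊆ (univ : Finset (Fin n → Bool)).biUnion fun σ =>
          (univ : Finset (Fin m → Fin k → Fin n × Bool)).filter fun Φ =>
            ∀ i, ∃ j, σ (Φ i j).1 = (Φ i j).2 := by
    intro Φ hΦ
    simp only [mem_filter, mem_univ, true_and] at hΦ
    simp only [mem_biUnion, mem_univ, true_and, mem_filter]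
    exact hΦ
  calc _ ≤ _ := Finset.card_le_card hsub
    _ ≤ ∑ σ : Fin n → Bool, ((univ : Finset (Fin m → Fin k → Fin n × Bool)).filter fun Φ =>
          ∀ i, ∃ j, σ (Φ i j).1 = (Φ i j).2).card := Finset.card_biUnion_le
    _ = 2 ^ n * ((2 * n) ^ k - n ^ k) ^ m := by
        simp only [ur_card_satBy, Finset.sum_const, Finset.card_univ, Fintype.card_fun,
          Fintype.card_bool, Fintype.card_fin, smul_eq_mul]

/-- The satisfiable fraction is at most `2^n (1 - 2^{-k})^m` (for `n ≥ 1`). -/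
theorem ur_sat_fraction_le (n k m : ℕ) (hn : 1 ≤ n) :
    (((univ : Finset (Fin m → Fin k → Fin n × Bool)).filter fun Φ =>
        ∃ σ : Fin n → Bool, ∀ i, ∃ j, σ (Φ i j).1 = (Φ i j).2).card : ℝ)
      / Fintype.card (Fin m → Fin k → Fin n × Bool)
      ≤ 2 ^ n * (1 - (1 / 2 : ℝ) ^ k) ^ m := by
  have hN : (Fintype.card (Fin m → Fin k → Fin n × Bool) : ℝ) = ((2 * n : ℝ) ^ k) ^ m := by
    rw [Fintype.card_fun, Fintype.card_fun, Fintype.card_prod, Fintype.card_fin, Fintype.card_fin,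
      Fintype.card_bool, Fintype.card_fin]
    push_cast; ring
  have hn0 : (0 : ℝ) < n := by exact_mod_cast hn
  have h2n : (0 : ℝ) < (2 * n : ℝ) ^ k := by positivity
  rw [hN, div_le_iff₀ (by positivity)]
  have h := ur_card_sat_le n k m
  have hle : n ^ k ≤ (2 * n) ^ k := Nat.pow_le_pow_left (by omega) k
  have h' : (((univ : Finset (Fin m → Fin k → Fin n × Bool)).filter fun Φ =>
        ∃ σ : Fin n → Bool, ∀ i, ∃ j, σ (Φ i j).1 = (Φ i j).2).card : ℝ)
      ≤ 2 ^ n * ((2 * n : ℝ) ^ k - (n : ℝ) ^ k) ^ m := by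
    have := (Nat.cast_le (α := ℝ)).2 h
    push_cast [Nat.cast_sub hle] at this
    exact this
  refine h'.trans (le_of_eq ?_)
  have hq : (2 * n : ℝ) ^ k - (n : ℝ) ^ k = (1 - (1 / 2 : ℝ) ^ k) * (2 * n : ℝ) ^ k := by
    rw [mul_pow, one_div, inv_pow]; field_simp
  rw [hq, mul_pow]; ring

/-- **No map succeeds at density `α ≥ 2^k`.** For every `f : instances ↦ assignments` (given here in the
crux's input/output format: `f` reads the `encodingCNF` of the clause list and its output word is read
as an assignment) and every `ε > 0`, eventually the fraction of instances solved by `f` is `< ε`. -/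
theorem ur_no_solver (k : ℕ) (hk : 1 ≤ k) (α : ℝ) (hα : (2 : ℝ) ^ k ≤ α) (f : List Bool → List Bool)
    (ε : ℝ) (hε : 0 < ε) :
    ∀ᶠ n : ℕ in Filter.atTop, ∀ m : ℕ, m = ⌊α * n⌋₊ →
      ((Finset.univ.filter fun Φ : Fin m → Fin k → Fin n × Bool => ∀ i, ∃ j,
          (f (Literature.Computability.Complexity.encodingCNF.encode (List.ofFn fun a =>
            List.ofFn fun b => (((Φ a b).1 : ℕ), (Φ a b).2)))).getD (Φ i j).1 false =
              (Φ i j).2).card : ℝ) / Fintype.card (Fin m → Fin k → Fin n × Bool) < ε := by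
  -- `e · (2/e)^n → 0`
  have hgeo : Filter.Tendsto (fun n : ℕ => Real.exp 1 * (2 / Real.exp 1) ^ n) Filter.atTop (nhds 0) := by
    have h2e : (2 : ℝ) / Real.exp 1 < 1 := by
      rw [div_lt_one (Real.exp_pos 1)]
      have := Real.add_one_lt_exp (by norm_num : (1 : ℝ) ≠ 0)
      linarith
    have := tendsto_pow_atTop_nhds_zero_of_lt_one (by positivity) h2e
    simpa using this.const_mul (Real.exp 1)
  filter_upwards [hgeo.eventually (gt_mem_nhds hε), Filter.eventually_ge_atTop 1] with n hsmall hn1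
  intro m hm
  set p : ℝ := (1 / 2 : ℝ) ^ k with hp
  have hp0 : 0 < p := by positivity
  have hp1 : p ≤ 1 / 2 := by
    rw [hp]; exact pow_le_of_le_one (by norm_num) (by norm_num) (by omega)
  -- solved ⇒ satisfiable
  have hsub : ((Finset.univ.filter fun Φ : Fin m → Fin k → Fin n × Bool => ∀ i, ∃ j,
        (f (Literature.Computability.Complexity.encodingCNF.encode (List.ofFn fun a =>
          List.ofFn fun b => (((Φ a b).1 : ℕ), (Φ a b).2)))).getD (Φ i j).1 false =
            (Φ i j).2).card : ℝ)
      ≤ (((univ : Finset (Fin m → Fin k → Fin n × Bool)).filter fun Φ =>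
          ∃ σ : Fin n → Bool, ∀ i, ∃ j, σ (Φ i j).1 = (Φ i j).2).card : ℝ) := by
    exact_mod_cast Finset.card_le_card fun Φ hΦ => by
      simp only [mem_filter, mem_univ, true_and] at hΦ ⊢
      exact ⟨fun v => (f (Literature.Computability.Complexity.encodingCNF.encode (List.ofFn fun a =>
          List.ofFn fun b => (((Φ a b).1 : ℕ), (Φ a b).2)))).getD v false, hΦ⟩
  have hcard : (0 : ℝ) < Fintype.card (Fin m → Fin k → Fin n × Bool) := by
    haveI : Nonempty (Fin n × Bool) := ⟨(⟨0, hn1⟩, false)⟩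
    exact_mod_cast Fintype.card_pos
  refine lt_of_le_of_lt ((div_le_div_of_nonneg_right hsub hcard.le).trans
    (ur_sat_fraction_le n k m hn1)) (lt_of_le_of_lt ?_ hsmall)
  -- `2^n (1-p)^m ≤ 2^n e^{-p m} ≤ 2^n e^{-p(αn-1)} ≤ e (2/e)^n`
  have h1 : (1 - p) ^ m ≤ Real.exp (-(p * m)) := by
    calc (1 - p) ^ m ≤ (Real.exp (-p)) ^ m :=
          pow_le_pow_left₀ (by linarith) (by linarith [Real.one_sub_le_exp_neg p]) m
      _ = Real.exp (-(p * m)) := by rw [← Real.exp_nat_mul]; ring_nf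
  have hmge : α * n - 1 ≤ (m : ℝ) := by
    rw [hm]; have := Nat.lt_floor_add_one (α * n); linarith
  have hpα : 1 ≤ p * α := by
    have : p * (2 : ℝ) ^ k = 1 := by rw [hp, one_div, inv_pow, inv_mul_cancel₀ (by positivity)]
    nlinarith
  have h2 : Real.exp (-(p * m)) ≤ Real.exp 1 * Real.exp (-(n : ℝ)) := by
    rw [← Real.exp_add, Real.exp_le_exp]
    have hn0 : (0 : ℝ) ≤ n := Nat.cast_nonneg n
    nlinarith [mul_le_mul_of_nonneg_left hmge hp0.le]
  have h3 : (2 : ℝ) ^ n * (Real.exp 1 * Real.exp (-(n : ℝ))) = Real.exp 1 * (2 / Real.exp 1) ^ n := by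
    rw [div_pow, Real.exp_neg, ← Real.exp_one_pow n]; ring
  calc (2 : ℝ) ^ n * (1 - (1 / 2 : ℝ) ^ k) ^ m = 2 ^ n * (1 - p) ^ m := by rw [hp]
    _ ≤ 2 ^ n * (Real.exp 1 * Real.exp (-(n : ℝ))) :=
        mul_le_mul_of_nonneg_left (h1.trans h2) (by positivity)
    _ = Real.exp 1 * (2 / Real.exp 1) ^ n := h3

/-- **The crux is vacuously true at density `α ≥ 2^k`:** its hypothesis (some map — here not even
required to be polynomial-time — solves `F_k(n, ⌊αn⌋)` with probability `≥ ε` for infinitely many `n`)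
is FALSE there. Stated for the exact hypothesis shape of `SolvableImpliesStableSection`. -/
theorem solvableImpliesStableSection_hyp_false_of_density_ge (k : ℕ) (hk : 1 ≤ k) (α : ℝ)
    (hα : (2 : ℝ) ^ k ≤ α) :
    ¬ (∃ f : List Bool → List Bool, Literature.Computability.Complexity.IsPolyTime f ∧
      ∃ ε : ℝ, 0 < ε ∧ ∃ᶠ n : ℕ in Filter.atTop, ∀ m : ℕ, m = ⌊α * n⌋₊ → ε ≤
        ((Finset.univ.filter fun Φ : Fin m → Fin k → Fin n × Bool => ∀ i, ∃ j,
          (f (Literature.Computability.Complexity.encodingCNF.encode (List.ofFn fun a =>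
            List.ofFn fun b => (((Φ a b).1 : ℕ), (Φ a b).2)))).getD (Φ i j).1 false =
              (Φ i j).2).card : ℝ) / Fintype.card (Fin m → Fin k → Fin n × Bool)) := by
  rintro ⟨f, -, ε, hε, hfreq⟩
  have hev := ur_no_solver k hk α hα f ε hε
  refine (hfreq.and_eventually hev).exists.elim fun n hn => ?_
  obtain ⟨h1, h2⟩ := hn
  exact absurd (h1 _ rfl) (not_le.2 (h2 _ rfl))

end Summit.PneNP.PneNP.Cruxes.SolvableImpliesStableSection.Sketch
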